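/- Copyright: the b2b-balaban cell (near-miss cell 7), T⁴-continuum fan-out, lineage t4-ne7b-p1 (node U5c COUNT
member).  Released under the licence of the surrounding project. -/
import Summits.QuantumFields.BalabanUV.T4Continuum.Support.HistoryGenealogyPedigreeOrder
import Summits.QuantumFields.BalabanUV.T4Continuum.Support.HistoryRealiseCells

/-!
# THE PEDIGREE OF A COMPONENT HISTORY, part 6 (junction M4, brick 3a — tracking and root cells): the last-event
domain of every component TRACKS the re-blocked anchor of its first-born constituent, and the root cell of every
component's `PGen` is one of print's new regions, born at the root step (owner module of row NE7b, lineage `t4-ne7b-p1`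
gen 41; re-open object (α), `SCOPE-alpha.md` v2.3 §5 row M4, D-M4-4 — PRE-POSITIONING ONLY)

Summits-side support leaf of the T⁴-continuum cell (rung (B)+1 on a FINITE torus only; NOT infinite volume, NOT the
mass gap, NOT the Clay statement; NOT a proof of the spine estimate NE7b, which is the cell's OWN estimate, NOT PRINTED
and NOT PROVED).  [folklore] finite combinatorics in the ℤᵈ index model over parts 1–5 (`pedOf`, `ordOf`, `ppair`,
`realisesW_toPGen`, `OrdSpec`∕`HeadCond`), leaf-08's `HistoryRealiseCells` (`anchorAt`, `curDomain`, `coarse_anchorAt`,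
`anchorAt_mem_curDomain`, `coarse_Qfrom_mem_orbit`) and the core (`rootAnchor`, `rootRegion`); nothing printed is
asserted, no `def … : Prop` fact of Bałaban's (`CoverOK` is a displayed hypothesis SHAPE), zero `sorry`.  B15 =
[Balaban1989LargeFieldI] p. 177 and B16 = [Balaban1989LargeFieldII] (1.76)∕(1.84) under audit; locators only.

WHY.  Two of the END's reading fields are about the ROOT of a live structure: `track` — the last-event domain contains
the anchor cube of the first-born constituent re-blocked to the last step (`anchorAt L s P P.lastStep ∈ Z`; with
`anchorAt_mem_curDomain` this puts the re-blocked anchor inside the current domain at the cutoff, the injectivity device of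
the root-cell count) — and `inBox` — the root anchor lies in the period box at its birth scale.  Neither follows from
`RealisesW` alone (a join's domain is only asked to lie INSIDE the union of the images); both follow for print's process,
whose domains CONTAIN the constituents' images — B15 p. 177 «Each renormalization step adds at least ten layers of
MR_k-cubes to the previous large field region», (1.76)∕(1.84) — displayed here as the hypothesis shape `CoverOK` (for the
cell's `RunInput(M)` it holds by definition: `dom = fam`).  THIS FILE proves, for the pedigree in the chosen order:
(§1) the root step ∕ root cell of a left-nested chain headed by a member of minimal root step are the head's; (§2) the
head of `ordOf` has minimal root step among the constituents' `PGen`s (old head: `HeadCond` + `rootStep_toPGen_eq_pgenR`;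
fresh cluster or level `0`: all equal); (§3) **`anchorAt_toPGen_mem_edomR`** (`track` at the level of the last event, by
induction: birth — the anchor is in its region; lone part — inherited ∕ one S-step (`coarse_mem_Sop`); chain — the head's
anchor lies in the head's image, which `CoverOK` puts inside the domain); sibling `…PedigreeRoot`: `rootCell_toPGen_mem_newReg` (the root cell is a new region of print's bookkeeping born at the
root step — the `inBox` field then follows from a displayed box condition on the new regions, brick 3b).

HONEST.  Proves nothing of Bałaban's; `CoverOK` displayed; NE7b NOT proved; spine 0∕9.  HONEST DEPENDENCY (cell):
continuum YM on T⁴ ⇐ BetaPertH ∧ nine spine estimates (0/9 proved); BetaPertH ⇐ (D1) ∧ (D4) ∧ CAP+tail; G-an2-4 gates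
asym, D1 and NE2/3/4.  This file changes none of it. -/

open Finset
open Literature.MathematicalPhysics.QuantumFieldTheory.Balaban1983to89
open Literature.MathematicalPhysics.QuantumFieldTheory.Balaban1983to89.B13ScaleTransfer
open Literature.MathematicalPhysics.QuantumFieldTheory.Balaban1983to89.B16SProfile
open Literature.MathematicalPhysics.QuantumFieldTheory.Balaban1983to89.B16MergeGeometry
open T4PersistenceDictionary
open Summit.QuantumFields.BalabanUV.T4Continuum.HistoryAdmissible
open Summit.QuantumFields.BalabanUV.T4Continuum.HistoryRealise
open Summit.QuantumFields.BalabanUV.T4Continuum.HistoryRealiseWeak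
open Summit.QuantumFields.BalabanUV.T4Continuum.HistoryRealiseCells
open Summit.QuantumFields.BalabanUV.T4Continuum.HistoryGen
open Summit.QuantumFields.BalabanUV.T4Continuum.HistoryGenealogyExtraction
open Summit.QuantumFields.BalabanUV.T4Continuum.HistoryGenealogyRealise
open Summit.QuantumFields.BalabanUV.T4Continuum.HistoryGenealogyRealise.GeomHistoryR

namespace Summit.QuantumFields.BalabanUV.T4Continuum.HistoryGenealogyPedigree

noncomputable section

variable {d : ℕ}

/-! ## §1 Root step and root cell of a chain headed by a member of minimal root step -/

section ChainRoot

variable {γ : Type*}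

/-- **THE ROOT OF A LEFT-NESTED CHAIN WITH AN OLDEST HEAD IS THE HEAD'S ROOT**: root step and root cell (ties go to the
accumulated left part, whose root is the head's by induction). [folklore] -/
theorem rootStep_rootCell_chainJoin_of_head_min (s : ℕ) :
    ∀ (A : PGen γ) (Bs : List (PGen γ)), (∀ B ∈ Bs, A.rootStep ≤ B.rootStep) →
      (chainJoin A Bs s).rootStep = A.rootStep ∧ (chainJoin A Bs s).rootCell = A.rootCell
  | _, [], _ => ⟨rfl, rfl⟩
  | A, B :: Bs, h => by
      have hAB : A.rootStep ≤ B.rootStep := h B List.mem_cons_self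
      have h1 : (PGen.join A B s).rootStep = A.rootStep := by rw [PGen.rootStep]; exact min_eq_left hAB
      have h2 : (PGen.join A B s).rootCell = A.rootCell := by rw [PGen.rootCell, if_pos hAB]
      obtain ⟨hr, hc⟩ := rootStep_rootCell_chainJoin_of_head_min s (PGen.join A B s) Bs
        (fun C hC => by rw [h1]; exact h C (List.mem_cons_of_mem _ hC))
      rw [chainJoin, hr, hc, h1, h2]
      exact ⟨rfl, rfl⟩

end ChainRoot

/-! ## §2 The head of the chosen order has minimal root step -/

section HeadMin

variable {L : ℕ} {s R : ℕ → ℕ} {H : ComponentHistory (Lab d)} {rnw : ℕ → Lab d → Bool}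
  {dom : ℕ → Lab d → Finset (Pt d)}

/-- root step of a constituent pair at a successor level: an old part's line's, the level for a new region [folklore] -/
theorem rootStep_fst_ppair {ord : ℕ → Lab d → List (Lab d ⊕ Lab d)} (j : ℕ) (q : Lab d ⊕ Lab d) :
    (ppair H rnw ord dom L s j q).1.rootStep =
      Sum.elim (fun p => ((pedOf H rnw ord).toPGen id (j, p)).rootStep) (fun _ => j + 1) q := by
  cases q with
  | inl p => by_cases h : rnw j p = true <;> simp [ppair, h, PGen.rootStep]
  | inr n => simp [ppair, PGen.rootStep]

/-- root cell of a constituent pair: an old part's line's, the region itself for a new region [folklore] -/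
theorem rootCell_fst_ppair {ord : ℕ → Lab d → List (Lab d ⊕ Lab d)} (j : ℕ) (q : Lab d ⊕ Lab d) :
    (ppair H rnw ord dom L s j q).1.rootCell =
      Sum.elim (fun p => ((pedOf H rnw ord).toPGen id (j, p)).rootCell) (fun n => n) q := by
  cases q with
  | inl p => by_cases h : rnw j p = true <;> simp [ppair, h, PGen.rootCell]
  | inr n => simp [ppair, PGen.rootCell]

/-- **THE HEAD OF THE CHOSEN ORDER HAS MINIMAL ROOT STEP among the constituents' `PGen`s** (successor level: an old
head of minimal extraction root step, or all constituents new). [folklore] -/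
theorem rootStep_head_le_ordOf (hW : H.WF) (hG : LevelClausesW H rnw dom L s R) {j : ℕ} {c : Lab d}
    (hc : c ∈ H.comp (j + 1)) {q₀ q₁ : Lab d ⊕ Lab d} {qs : List (Lab d ⊕ Lab d)}
    (hq : ordOf H rnw dom L s (j + 1) c = q₀ :: q₁ :: qs) :
    ∀ q ∈ q₁ :: qs, (ppair H rnw (ordOf H rnw dom L s) dom L s j q₀).1.rootStep ≤
      (ppair H rnw (ordOf H rnw dom L s) dom L s j q).1.rootStep := by
  have hO := orderOK_ordOf hW hG (rnw := rnw)
  obtain ⟨-, -, hspec⟩ := ordSpec_ordOf hW hG hc (rnw := rnw)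
  have hhead := (hspec q₀ q₁ qs hq).2
  have hmem : ∀ q ∈ q₀ :: q₁ :: qs, q ∈ H.constit (j + 1) c := fun q hq' => (hO (j + 1) c hc).mem_iff.1 (hq ▸ hq')
  intro q hq'
  rw [rootStep_fst_ppair, rootStep_fst_ppair]
  -- root steps of old constituents are their extraction root steps `≤ j`
  have hold : ∀ p, Sum.inl p ∈ q₀ :: q₁ :: qs →
      ((pedOf H rnw (ordOf H rnw dom L s)).toPGen id (j, p)).rootStep = (H.pgenR rnw j p).rootStep ∧
        (H.pgenR rnw j p).rootStep ≤ j ∧ p ∈ H.parts (j + 1) c := by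
    intro p hp
    have hpp : p ∈ H.parts (j + 1) c := (mem_lefts_iff p _).2 (hmem _ hp)
    exact ⟨rootStep_toPGen_eq_pgenR id hW hO j p (hW.parts_sub j c hc p hpp), H.rootStep_pgenR_le rnw j p, hpp⟩
  by_cases hparts : H.parts (j + 1) c = []
  · -- a fresh cluster: every constituent is new, all root steps are `j + 1`
    have hq₀ : ∃ n, q₀ = Sum.inr n := by
      cases q₀ with
      | inr n => exact ⟨n, rfl⟩
      | inl p => exact absurd (hold p List.mem_cons_self).2.2 (by rw [hparts]; simp)
    have hqn : ∃ n, q = Sum.inr n := by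
      cases q with
      | inr n => exact ⟨n, rfl⟩
      | inl p => exact absurd (hold p (List.mem_cons_of_mem _ hq')).2.2 (by rw [hparts]; simp)
    obtain ⟨n₀, rfl⟩ := hq₀
    obtain ⟨n, rfl⟩ := hqn
    simp
  · obtain ⟨p₀, rfl, hmin⟩ := hhead hparts
    obtain ⟨he₀, hle₀, -⟩ := hold p₀ List.mem_cons_self
    simp only [Sum.elim_inl, he₀]
    cases q with
    | inr n => simp only [Sum.elim_inr]; omega
    | inl p =>
        obtain ⟨he, -, hpp⟩ := hold p (List.mem_cons_of_mem _ hq')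
        simp only [Sum.elim_inl, he]
        exact hmin p hpp

end HeadMin

/-! ## §3 Tracking: the last-event domain contains the re-blocked root anchor -/

section Cover

/-- **THE DISPLAYED COVER CONDITION**: the domain of a component CONTAINS the images of its constituents (B15 p. 177:
each step «adds … layers … to the previous large field region»; for the cell's `RunInput(M)` the domain IS the union of
the images). [folklore] -/
def CoverOK (H : ComponentHistory (Lab d)) (dom : ℕ → Lab d → Finset (Pt d)) (L : ℕ) (s : ℕ → ℕ) : Prop :=
  ∀ j c, c ∈ H.comp j → ∀ q ∈ H.constit j c, imgC L s dom j q ⊆ dom j c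

end Cover

section Track

variable {L : ℕ} {s R : ℕ → ℕ} {H : ComponentHistory (Lab d)} {rnw : ℕ → Lab d → Bool}
  {dom : ℕ → Lab d → Finset (Pt d)}

/-- the anchor of a birth at its own step is the region's anchor [folklore] -/
theorem anchorAt_birth (j cls : ℕ) (n : Lab d) : anchorAt L s (PGen.birth j cls n) j = n.1 := by
  simp [anchorAt, PGen.rootStep, rootAnchor, PGen.rootCell, coarse_one]

/-- re-blocking past the last event keeps the anchor inside the orbit of a tracking domain [folklore] -/
theorem anchorAt_mem_orbit_of_track {P : PGen (Lab d)} {Z : Finset (Pt d)} (htr : anchorAt L s P P.lastStep ∈ Z)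
    (hj : P.rootStep ≤ P.lastStep) {u : ℕ} (hu : P.lastStep ≤ u) :
    anchorAt L s P u ∈ orbit L s P.lastStep Z (u - P.lastStep) :=
  anchorAt_mem_curDomain L s htr hj hu

/-- **`track` AT THE LAST EVENT**: for every component, the last-event domain contains the root anchor re-blocked to
the last step (under `WF`, the clauses and the cover condition; chosen order). [folklore] -/
theorem anchorAt_toPGen_mem_edomR (hW : H.WF) (hG : LevelClausesW H rnw dom L s R) (hC : CoverOK H dom L s) :
    ∀ (j : ℕ) (c : Lab d), c ∈ H.comp j →
      anchorAt L s ((pedOf H rnw (ordOf H rnw dom L s)).toPGen id (j, c))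
        ((pedOf H rnw (ordOf H rnw dom L s)).toPGen id (j, c)).lastStep ∈ edomR H rnw dom j c := by
  have hO := orderOK_ordOf hW hG (rnw := rnw)
  set ord := ordOf H rnw dom L s with hord
  intro j
  induction j with
  | zero =>
      intro c hc
      -- level 0: a lone birth (a fresh cluster is handled like the successor chain case)
      have hl0 : lefts (ord 0 c) = [] := lefts_ord_zero hW hO hc
      obtain ⟨q₀, qs, hqs⟩ := List.exists_cons_of_ne_nil (ord_ne_nil hW hO hc)
      obtain ⟨n₀, rfl⟩ := exists_inr_of_lefts_eq_nil hl0 q₀ (by rw [hqs]; exact List.mem_cons_self)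
      have hn₀ : n₀ ∈ H.newReg 0 :=
        hW.news_sub 0 c hc n₀ (mem_news_of_inr_mem_ord hO hc (by rw [hqs]; exact List.mem_cons_self))
      rw [edomR_zero]
      cases qs with
      | nil =>
          have hcs := constit_eq_singleton_of_ord hO hc hqs
          have hrights : rights (ord 0 c) = [n₀] := by rw [hqs]; rfl
          rw [toPGen_zero_birth H rnw ord id hc hrights, hG.dom_birth 0 c n₀ hc hcs]
          simp only [PGen.lastStep, anchorAt_birth, id]
          exact (hG.new_ok 0 n₀ hn₀).1
      | cons q₁ qs' =>
          -- chain of births at step 0: the root is the head's region, inside the domain by the cover condition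
          have hmem : ∀ x ∈ ord 0 c, ∃ n, x = Sum.inr n ∧ n ∈ H.newReg 0 := by
            intro x hx
            obtain ⟨n, rfl⟩ := exists_inr_of_lefts_eq_nil hl0 x hx
            exact ⟨n, rfl, hW.news_sub 0 c hc n (mem_news_of_inr_mem_ord hO hc hx)⟩
          have hrights : (rights (ord 0 c)).map (fun n => PGen.birth 0 (H.cls n) (id n)) =
              (ord 0 c).map (Sum.elim (fun p => (pedOf H rnw ord).toPGen id (0, p)) fun n => PGen.birth 0 (H.cls n) n) :=
            (map_sum_elim_of_lefts_eq_nil _ _ _ hl0).symm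
          have hchain : (pedOf H rnw ord).toPGen id (0, c) =
              chainJoin (PGen.birth 0 (H.cls n₀) n₀)
                ((q₁ :: qs').map (Sum.elim (fun p => (pedOf H rnw ord).toPGen id (0, p)) fun n =>
                  PGen.birth 0 (H.cls n) n)) 0 := by
            rw [toPGen_zero H rnw ord id hc, hrights, hqs]; rfl
          have hmin : ∀ B ∈ (q₁ :: qs').map (Sum.elim (fun p => (pedOf H rnw ord).toPGen id (0, p)) fun n =>
              PGen.birth 0 (H.cls n) n), (PGen.birth 0 (H.cls n₀) n₀).rootStep ≤ B.rootStep := by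
            intro B hB
            obtain ⟨x, hx, rfl⟩ := List.mem_map.1 hB
            obtain ⟨n, rfl, -⟩ := hmem x (by rw [hqs]; exact List.mem_cons_of_mem _ hx)
            simp [PGen.rootStep]
          obtain ⟨hrs, hrc⟩ := rootStep_rootCell_chainJoin_of_head_min 0 _ _ hmin
          have hlast : ((pedOf H rnw ord).toPGen id (0, c)).lastStep = 0 := by
            rw [hchain]; exact lastStep_chainJoin_cons _ _ _ 0
          rw [hlast]
          unfold anchorAt rootAnchor
          rw [hchain, hrs, hrc]
          simp only [PGen.rootStep, PGen.rootCell, Nat.sub_self, Qfrom_zero, coarse_one]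
          exact hC 0 c hc (Sum.inr n₀) ((hO 0 c hc).mem_iff.1 (by rw [hqs]; exact List.mem_cons_self))
            (by simpa using (hG.new_ok 0 n₀ hn₀).1)
  | succ j ih =>
      intro c hc
      obtain ⟨q₀, qs, hqs⟩ := List.exists_cons_of_ne_nil (ord_ne_nil hW hO hc)
      -- an old part's anchor re-blocked to `j + 1` lies in its image
      have hstep : ∀ p ∈ H.parts (j + 1) c,
          anchorAt L s ((pedOf H rnw ord).toPGen id (j, p)) (j + 1) ∈ Sop (ratio L s j) (dom j p) := by
        intro p hp
        have hpc : p ∈ H.comp j := hW.parts_sub j c hc p hp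
        have hreal := realisesW_toPGen_ordOf hW hG hpc (rnw := rnw)
        rw [← hord] at hreal
        have hle : ((pedOf H rnw ord).toPGen id (j, p)).lastStep ≤ j := by
          have := (lastStep_toPGen_ordOf hW hG hpc (rnw := rnw)).2
          rwa [← hord] at this
        have h := anchorAt_mem_orbit_of_track (ih p hpc) (rootStep_le_lastStep_of_realisesW hreal.1)
          (u := j + 1) (by omega)
        rw [hreal.2, ← orbit_level_succ L s hle]
        exact h
      cases qs with
      | nil =>
          have hcs := constit_eq_singleton_of_ord hO hc hqs
          cases q₀ with
          | inl p =>
              have hp : p ∈ H.parts (j + 1) c := by simp [ComponentHistory.parts, hcs]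
              have hflow := hG.dom_flow j c p hc hcs
              cases hf : rnw j p with
              | false =>
                  rw [toPGen_succ_lone H rnw ord id hc hqs hf, edomR_succ_lone H rnw dom hcs hf]
                  exact ih p (hW.parts_sub j c hc p hp)
              | true =>
                  have hev : edomR H rnw dom (j + 1) c = dom (j + 1) c :=
                    edomR_succ_event H rnw dom (by simp [lonePartR, hcs, hf])
                  rw [toPGen_succ_renew H rnw ord id hc hqs hf, hev, hflow]
                  simp only [PGen.lastStep]
                  have h := hstep p hp
                  simpa [anchorAt, PGen.rootStep, rootAnchor, PGen.rootCell] using h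
          | inr n =>
              have hn : n ∈ H.newReg (j + 1) := hW.news_sub (j + 1) c hc n (by simp [ComponentHistory.news, hcs])
              have hev : edomR H rnw dom (j + 1) c = dom (j + 1) c :=
                edomR_succ_event H rnw dom (by simp [lonePartR, hcs])
              rw [toPGen_succ_birth H rnw ord id hc hqs, hev, hG.dom_birth (j + 1) c n hc hcs]
              simp only [PGen.lastStep, anchorAt_birth, id]
              exact (hG.new_ok (j + 1) n hn).1
      | cons q₁ qs' =>
          have h2 := two_le_length_constit_of_ord hO hc hqs
          have hev : edomR H rnw dom (j + 1) c = dom (j + 1) c := by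
            refine edomR_succ_event H rnw dom ?_
            obtain ⟨x, l, hxl⟩ := List.exists_cons_of_ne_nil (hW.nonempty (j + 1) c hc)
            cases l with
            | nil => rw [hxl] at h2; simp at h2
            | cons y l' => rw [hxl]; cases x <;> rfl
          have hchain : (pedOf H rnw ord).toPGen id (j + 1, c) =
              chainJoin (ppair H rnw ord dom L s j q₀).1 ((q₁ :: qs').map fun x => (ppair H rnw ord dom L s j x).1)
                (j + 1) := by
            rw [toPGen_succ_chain H rnw ord id hc hqs, fst_ppair]
            congr 1
            exact List.map_congr_left fun x _ => (fst_ppair j x).symm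
          have hmin : ∀ B ∈ (q₁ :: qs').map (fun x => (ppair H rnw ord dom L s j x).1),
              (ppair H rnw ord dom L s j q₀).1.rootStep ≤ B.rootStep := by
            intro B hB
            obtain ⟨x, hx, rfl⟩ := List.mem_map.1 hB
            exact rootStep_head_le_ordOf hW hG hc hqs x hx
          obtain ⟨hrs, hrc⟩ := rootStep_rootCell_chainJoin_of_head_min (j + 1) _ _ hmin
          have hlast : ((pedOf H rnw ord).toPGen id (j + 1, c)).lastStep = j + 1 := by
            rw [hchain]; exact lastStep_chainJoin_cons _ _ _ (j + 1)
          have hq₀c : q₀ ∈ H.constit (j + 1) c := (hO (j + 1) c hc).mem_iff.1 (by rw [hqs]; exact List.mem_cons_self)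
          -- the chain's anchor at `j + 1` is the head's anchor at `j + 1`, inside the head's image
          have key : anchorAt L s ((pedOf H rnw ord).toPGen id (j + 1, c)) (j + 1) ∈ imgC L s dom (j + 1) q₀ := by
            unfold anchorAt rootAnchor
            rw [hchain, hrs, hrc, rootStep_fst_ppair, rootCell_fst_ppair]
            cases q₀ with
            | inr n =>
                simp only [Sum.elim_inr, Nat.sub_self, Qfrom_zero, coarse_one, imgC_inr]
                exact (hG.new_ok (j + 1) n (hW.news_sub (j + 1) c hc n ((mem_rights_iff n _).2 hq₀c))).1
            | inl p =>
                have hp : p ∈ H.parts (j + 1) c := (mem_lefts_iff p _).2 hq₀c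
                simp only [Sum.elim_inl, imgC_inl, Nat.add_sub_cancel]
                exact hstep p hp
          rw [hlast, hev]
          exact hC (j + 1) c hc q₀ hq₀c key

end Track

end

end Summit.QuantumFields.BalabanUV.T4Continuum.HistoryGenealogyPedigree
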